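import Literature.AlgebraicGeometry.Morphisms.FormalFunctionsProofs
import Mathlib.AlgebraicGeometry.Morphisms.Proper
import Mathlib.AlgebraicGeometry.Morphisms.FiniteType
import Mathlib.AlgebraicGeometry.Noetherian
import Mathlib.AlgebraicGeometry.ResidueField
import Mathlib.RingTheory.Filtration
import Mathlib.RingTheory.AdicCompletion.Basic
import HarnessLib

/-!
# Global functions on a proper scheme over a complete local ring from its formal levels

Topic `Literature/AlgebraicGeometry/Morphisms`; theorems only (no definition, no named fact, no
instance). Let `(R, 𝔪)` be a Noetherian local ring and `f : X → Spec R` proper, with infinitesimal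
neighbourhoods `X_n = X ×_R Spec (R/𝔪ⁿ⁺¹)` of the closed fibre (tree `FormalFunctions`:
`infinitesimalNeighbourhood`, `toSpec`, `restrict`, `algebraMapΓ`). Two elementary halves of the
«Stein property from the formal levels» (the `p = 0` shadow of the theorem on formal functions,
[GortzWedhorn2023] Thm. 24.37 / [Hartshorne1977] III.11.1, WITHOUT its Artin–Rees and
Mittag-Leffler inputs):

* `eq_zero_of_forall_restrict_eq_zero` — a global function vanishing on every `X_n` is `0`
  (Krull's intersection theorem on the affine pieces, [AtiyahMacdonald1969] Cor. 10.19: it is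
  killed by some `1 − r`, `r ∈ 𝔪𝒪`, hence vanishes on a neighbourhood of the closed fibre; a
  closed subset of `X` missing the closed fibre is empty because `f` is closed and every non-empty
  closed subset of `Spec R` contains the closed point);
* `bijective_algebraMapΓ_of_isAdicComplete` — if `R` is moreover `𝔪`-adically complete and every
  level is Stein (`R/𝔪ⁿ⁺¹ → Γ(X_n, 𝒪)` bijective), then `R → Γ(X, 𝒪_X)` is bijective: the
  compatible family `(m|_{X_n})ₙ` has a limit `r ∈ R` ([AtiyahMacdonald1969] Ch. 10, completeness),
  and `m − r` vanishes on every level.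

The consumer is the universal Stein property of abelian schemes (cohomological flatness in
dimension `0`, [GortzWedhorn2023] Cor. 24.63 / EGA III 7.8.6): the levels are Stein by the
Artin-local case, and the general Noetherian local base follows by flat base change to the
completion (`Morphisms/SteinOfLocalRing`).

## References
* [GortzWedhorn2023] U. Görtz, T. Wedhorn, *Algebraic Geometry II*, Thm. 24.37 and Section (24.7)
  (theorem on formal functions), Cor. 24.63 (Stein property for proper flat morphisms with
  geometrically reduced connected fibres).
* [AtiyahMacdonald1969] M. Atiyah, I. Macdonald, *Introduction to Commutative Algebra*,
  Cor. 10.19 (Krull's intersection theorem) and Ch. 10 (completions).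
* [Hartshorne1977] R. Hartshorne, *Algebraic Geometry*, III Thm. 11.1.
-/

noncomputable section

open CategoryTheory CategoryTheory.Limits AlgebraicGeometry TopologicalSpace Opposite IsLocalRing

universe u

namespace Literature.AlgebraicGeometry.Morphisms

open infinitesimalNeighbourhood

variable {R : Type u} [CommRing R] {X : Scheme.{u}} (f : X ⟶ Spec (.of R))

/-! ## §0 Plumbing: `algebraMapΓ` along a commutative square -/

/-- For a commutative square `z ≫ g = h ≫ Spec φ` of schemes over affine bases, pulling back
global functions sends `algebraMapΓ g b` to `algebraMapΓ h (φ b)`. [folklore] -/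
private theorem appTop_algebraMapΓ_of_comp_eq {B C : Type u} [CommRing B] [CommRing C]
    {Y Z : Scheme.{u}} (g : Y ⟶ Spec (.of B)) (h : Z ⟶ Spec (.of C)) (z : Z ⟶ Y)
    (φ : B →+* C) (w : z ≫ g = h ≫ Spec.map (CommRingCat.ofHom φ)) (b : B) :
    z.appTop.hom (algebraMapΓ g b) = algebraMapΓ h (φ b) := by
  have e1 : (g.appTop ≫ z.appTop).hom =
      ((Spec.map (CommRingCat.ofHom φ)).appTop ≫ h.appTop).hom := by
    rw [← Scheme.Hom.comp_appTop, ← Scheme.Hom.comp_appTop, w]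
  have e2 : (CommRingCat.ofHom φ ≫ (Scheme.ΓSpecIso (.of C)).inv).hom =
      ((Scheme.ΓSpecIso (.of B)).inv ≫ (Spec.map (CommRingCat.ofHom φ)).appTop).hom := by
    rw [Scheme.ΓSpecIso_inv_naturality]
  have e3 := congr($e1 ((Scheme.ΓSpecIso (.of B)).inv.hom b))
  have e4 := congr($e2 b)
  simp only [CommRingCat.hom_comp, CommRingCat.hom_ofHom, RingHom.coe_comp,
    Function.comp_apply] at e3 e4
  rw [algebraMapΓ, algebraMapΓ, RingHom.comp_apply, RingHom.comp_apply, e3, e4]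

/-- The levels are compatible: `(algebraMapΓ (toSpec (n+1)) (mk b))|_{X_n} = algebraMapΓ (toSpec n) (mk b)`.
[folklore] -/
private theorem transition_appTop_algebraMapΓ_toSpec (I : Ideal R) (n : ℕ) (b : R) :
    (transition I f n).appTop.hom
        (algebraMapΓ (toSpec I f (n + 1)) (Ideal.Quotient.mk (I ^ (n + 2)) b)) =
      algebraMapΓ (toSpec I f n) (Ideal.Quotient.mk (I ^ (n + 1)) b) := by
  rw [appTop_algebraMapΓ_of_comp_eq (toSpec I f (n + 1)) (toSpec I f n) (transition I f n)
    (transitionRingHom I n) (transition_toSpec I f n)]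
  rfl

/-- `restrict n (algebraMapΓ f b) = algebraMapΓ (toSpec n) (mk b)` (★ `restrict_algebraMapΓ`, in
`algebraMapΓ` notation). [folklore] -/
private theorem restrict_algebraMapΓ' (I : Ideal R) (n : ℕ) (b : R) :
    restrict I f n (algebraMapΓ f b) =
      algebraMapΓ (toSpec I f n) (Ideal.Quotient.mk (I ^ (n + 1)) b) :=
  restrict_algebraMapΓ I f n b

/-! ## §1 A global function vanishing on all infinitesimal neighbourhoods of the closed fibre is zero -/

variable [IsNoetherianRing R] [IsLocalRing R]

/-- On an affine open `W`, a global function vanishing on every `X_n` is killed by some `1 − r` with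
`r ∈ 𝔪 Γ(X, W)` (Krull's intersection theorem in the Noetherian ring `Γ(X, W)`).
[cite: AtiyahMacdonald1969, Cor. 10.19] -/
private theorem exists_one_sub_mul_resTop_eq_zero [LocallyOfFiniteType f] (m : Γ(X, ⊤))
    (hm : ∀ n, restrict (maximalIdeal R) f n m = 0) (W : X.affineOpens) :
    ∃ r ∈ (maximalIdeal R).map (algebraMap R (Sections f W)),
      (1 - r) * (Sections.equiv f W).symm (resTop X W m) = 0 := by
  haveI : IsLocallyNoetherian X := LocallyOfFiniteType.isLocallyNoetherian f
  haveI : IsNoetherianRing (Sections f W) := IsLocallyNoetherian.component_noetherian W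
  set J : Ideal (Sections f W) := (maximalIdeal R).map (algebraMap R (Sections f W)) with hJ
  set mW : Sections f W := (Sections.equiv f W).symm (resTop X W m) with hmW
  have hmem : ∀ i : ℕ, mW ∈ (J ^ i • ⊤ : Submodule (Sections f W) (Sections f W)) := fun i => by
    rw [Ideal.smul_eq_mul, Ideal.mul_top]
    have h := resTop_mem_map_pow_of_mem_ker (maximalIdeal R) f (n := i) (m := m)
      (RingHom.mem_ker.mpr (hm i)) W.2
    rw [Ideal.map_pow] at h
    exact Ideal.pow_le_pow_right (Nat.le_succ i) h
  obtain ⟨r, hr⟩ := (Ideal.mem_iInf_smul_pow_eq_bot_iff J mW).mp ((Submodule.mem_iInf _).mpr hmem)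
  refine ⟨r, r.2, ?_⟩
  rw [sub_mul, one_mul, sub_eq_zero]
  exact hr.symm

omit [IsNoetherianRing R] in
/-- At a point `x` of the closed fibre lying in the affine open `W`, every `r ∈ 𝔪 Γ(X, W)` has value
`0` in `κ(x)`. [folklore] -/
private theorem evaluation_eq_zero_of_mem_map {W : X.Opens} (x : X) (hx : x ∈ W)
    (hfx : f x = closedPoint R) {r : Sections f W}
    (hr : r ∈ (maximalIdeal R).map (algebraMap R (Sections f W))) :
    X.evaluation W x hx ((Sections.equiv f W) r) = 0 := by
  -- the ideal of functions vanishing at `x` contains the generators `a|_W`, `a ∈ 𝔪`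
  suffices h : (maximalIdeal R).map (algebraMap R (Sections f W)) ≤
      RingHom.ker ((X.evaluation W x hx).hom.comp (Sections.equiv f W).toRingHom) from
    RingHom.mem_ker.mp (h hr)
  rw [Ideal.map_le_iff_le_comap]
  intro a ha
  rw [Ideal.mem_comap, RingHom.mem_ker, RingHom.comp_apply]
  change X.evaluation W x hx (algebraMap R (Sections f W) a) = 0
  rw [Sections.algebraMap_apply, Scheme.evaluation_eq_zero_iff_notMem_basicOpen,
    Scheme.basicOpen_res]
  rintro ⟨-, hx'⟩
  -- `X.basicOpen (algebraMapΓ f a) = f⁻¹ D(a)` does not contain points of the closed fibre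
  have hpre : X.basicOpen (algebraMapΓ f a) =
      f ⁻¹ᵁ (Spec (.of R)).basicOpen ((Scheme.ΓSpecIso (.of R)).inv a) := by
    rw [Scheme.preimage_basicOpen]; rfl
  rw [hpre, basicOpen_eq_of_affine] at hx'
  have hx'' : closedPoint R ∈ PrimeSpectrum.basicOpen a := by
    have h : f x ∈ PrimeSpectrum.basicOpen a := hx'
    rwa [hfx] at h
  exact ((PrimeSpectrum.mem_basicOpen a (closedPoint R)).mp hx'') ha

/-- **A global function on `X` vanishing on every infinitesimal neighbourhood `X_n` of the closed
fibre is zero**, for `f : X → Spec R` universally closed and locally of finite type over a Noetherian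
local ring `(R, 𝔪)`. On an affine open `W` it is killed by some `1 − r`, `r ∈ 𝔪Γ(X, W)` (Krull),
so it vanishes on `D_W(1 − r)`, an open containing `W ∩ f⁻¹(𝔪)`; the union `W₀` of these opens
contains the closed fibre, and `f(X ∖ W₀)` is a closed subset of `Spec R` missing the closed point,
hence empty. [cite: AtiyahMacdonald1969, Cor. 10.19] [cite: GortzWedhorn2023, Thm. 24.37 and
Section (24.7)] -/
theorem eq_zero_of_forall_restrict_eq_zero [UniversallyClosed f] [LocallyOfFiniteType f]
    (m : Γ(X, ⊤)) (hm : ∀ n, restrict (maximalIdeal R) f n m = 0) : m = 0 := by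
  classical
  choose r hr hrm using exists_one_sub_mul_resTop_eq_zero f m hm
  -- the opens `D_W(1 - r_W)`
  let D : X.affineOpens → X.Opens := fun W => X.basicOpen ((Sections.equiv f W) (1 - r W))
  have hD_le : ∀ W, D W ≤ (W : X.Opens) := fun W => X.basicOpen_le _
  -- `m` vanishes on each `D W`
  have hmD : ∀ W, X.presheaf.map (homOfLE ((hD_le W).trans le_top)).op m = 0 := fun W => by
    have hW : IsAffineOpen (W : X.Opens) := W.2
    haveI := hW.isLocalization_basicOpen ((Sections.equiv f W) (1 - r W))
    have e : X.presheaf.map (homOfLE ((hD_le W).trans le_top)).op m =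
        algebraMap Γ(X, W) Γ(X, D W) (resTop X W m) := by
      rw [show (homOfLE ((hD_le W).trans le_top)).op =
        (homOfLE (le_top : (W : X.Opens) ≤ ⊤)).op ≫ (homOfLE (hD_le W)).op from rfl,
        Functor.map_comp]
      rfl
    rw [e, IsLocalization.map_eq_zero_iff (Submonoid.powers ((Sections.equiv f W) (1 - r W)))]
    exact ⟨⟨_, Submonoid.mem_powers _⟩, hrm W⟩
  -- every point of the closed fibre lies in some `D W`
  have hfib : ∀ x : X, f x = closedPoint R → ∃ W, x ∈ D W := fun x hx => by
    obtain ⟨W, hxW⟩ : ∃ W : X.affineOpens, x ∈ (W : X.Opens) := by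
      have := (iSup_affineOpens_eq_top X) ▸ (Opens.mem_top x : x ∈ (⊤ : X.Opens))
      exact Opens.mem_iSup.mp this
    refine ⟨W, ?_⟩
    have h0 : X.evaluation W x hxW ((Sections.equiv f W) (r W)) = 0 :=
      evaluation_eq_zero_of_mem_map f x hxW hx (hr W)
    have h1 : (Sections.equiv f W) (1 - r W) = 1 - (Sections.equiv f W) (r W) := by
      rw [map_sub, map_one]
    change x ∈ X.basicOpen _
    rw [← Scheme.evaluation_ne_zero_iff_mem_basicOpen (hx := hxW), h1, map_sub, map_one, h0,
      sub_zero]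
    exact one_ne_zero
  -- the closed set `X ∖ ⋃ D W` has closed image missing the closed point, hence is empty
  let W₀ : X.Opens := ⨆ W, D W
  have hZ : IsClosed (f '' (W₀ : Set X)ᶜ) := f.isClosedMap _ W₀.2.isClosed_compl
  have hnot : closedPoint R ∉ f '' (W₀ : Set X)ᶜ := by
    rintro ⟨x, hx, hfx⟩
    obtain ⟨W, hxW⟩ := hfib x hfx
    exact hx (Opens.mem_iSup.mpr ⟨W, hxW⟩)
  have hempty : f '' (W₀ : Set X)ᶜ = ∅ := by
    have hopen : closedPoint R ∈ (⟨(f '' (W₀ : Set X)ᶜ)ᶜ, hZ.isOpen_compl⟩ : Opens _) := hnot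
    have htop := (IsLocalRing.closedPoint_mem_iff _).mp hopen
    have hc := congrArg SetLike.coe htop
    rw [Opens.coe_top] at hc
    change (f '' (W₀ : Set X)ᶜ)ᶜ = Set.univ at hc
    rwa [Set.compl_univ_iff] at hc
  have hW₀ : W₀ = ⊤ := by
    rw [eq_top_iff]
    intro x _
    by_contra hx
    exact (Set.eq_empty_iff_forall_notMem.mp hempty) (f x) ⟨x, hx, rfl⟩
  -- conclude by the sheaf property on the cover `(D W)_W` of `X`
  apply X.sheaf.eq_of_locally_eq' (fun W => D W) ⊤ (fun W => homOfLE ((hD_le W).trans le_top))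
    (by rw [← hW₀]) m 0
  intro W
  rw [map_zero]
  exact hmD W

/-! ## §2 The complete case -/

omit [IsNoetherianRing R] [IsLocalRing R] in
/-- Injectivity of `R → Γ(X, 𝒪_X)` from injective levels and `⋂ₙ 𝔪ⁿ = 0`. [folklore] -/
private theorem injective_algebraMapΓ_of_levels (I : Ideal R) (hI : ⨅ n : ℕ, I ^ n = ⊥)
    (hlev : ∀ n, Function.Injective (algebraMapΓ (toSpec I f n))) :
    Function.Injective (algebraMapΓ f) := by
  rw [injective_iff_map_eq_zero]
  intro b hb
  have hmem : ∀ n, b ∈ I ^ (n + 1) := fun n => by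
    rw [← Ideal.Quotient.eq_zero_iff_mem]
    apply hlev n
    rw [map_zero, ← restrict_algebraMapΓ' f I n b, hb, map_zero]
  have : b ∈ (⨅ n : ℕ, I ^ n) := (Submodule.mem_iInf _).mpr fun n =>
    Ideal.pow_le_pow_right (Nat.le_succ n) (hmem n)
  rwa [hI] at this

/-- **Stein from the formal levels over a complete local ring.** Let `(R, 𝔪)` be a Noetherian local
ring, `𝔪`-adically complete, and `f : X → Spec R` proper such that every level
`R/𝔪ⁿ⁺¹ → Γ(X_n, 𝒪_{X_n})` is bijective. Then `R → Γ(X, 𝒪_X)` is bijective: injective by Krull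
(`⋂ 𝔪ⁿ = 0`); for surjectivity lift the compatible family `(m|_{X_n})ₙ` to `r ∈ R`
(completeness) and apply `eq_zero_of_forall_restrict_eq_zero` to `m − r`.
[cite: GortzWedhorn2023, Thm. 24.37 and Cor. 24.63] [cite: AtiyahMacdonald1969, Cor. 10.19] -/
theorem bijective_algebraMapΓ_of_isAdicComplete [IsAdicComplete (maximalIdeal R) R] [IsProper f]
    (hlev : ∀ n, Function.Bijective (algebraMapΓ (toSpec (maximalIdeal R) f n))) :
    Function.Bijective (algebraMapΓ f) := by
  refine ⟨injective_algebraMapΓ_of_levels f (maximalIdeal R)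
    (Ideal.iInf_pow_eq_bot_of_isLocalRing _ (maximalIdeal.isMaximal R).ne_top)
    fun n => (hlev n).1, fun m => ?_⟩
  -- lifts of the levels of `m`
  choose r hr using fun n => (hlev n).2 (restrict (maximalIdeal R) f n m)
  choose b hb using fun n => Ideal.Quotient.mk_surjective (r n)
  have hbres : ∀ n, algebraMapΓ (toSpec (maximalIdeal R) f n)
      (Ideal.Quotient.mk (maximalIdeal R ^ (n + 1)) (b n)) = restrict (maximalIdeal R) f n m :=
    fun n => by rw [hb n, hr n]
  -- compatibility `b (n+1) ≡ b n mod 𝔪ⁿ⁺¹`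
  have hcompat : ∀ n, b (n + 1) - b n ∈ maximalIdeal R ^ (n + 1) := fun n => by
    rw [← Ideal.Quotient.eq_zero_iff_mem, map_sub, sub_eq_zero]
    apply (hlev n).1
    rw [hbres n, ← transition_appTop_algebraMapΓ_toSpec f (maximalIdeal R) n (b (n + 1)),
      hbres (n + 1), transition_appTop_restrict]
  have hcompat' : ∀ k n, k ≤ n → b n - b k ∈ maximalIdeal R ^ (k + 1) := by
    intro k n hkn
    induction n, hkn using Nat.le_induction with
    | base => rw [sub_self]; exact Ideal.zero_mem _
    | succ n hkn ih =>
      rw [← sub_add_sub_cancel (b (n + 1)) (b n) (b k)]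
      exact Ideal.add_mem _ (Ideal.pow_le_pow_right (by omega) (hcompat n)) ih
  -- the limit in the complete ring `R`
  obtain ⟨L, hL⟩ := IsPrecomplete.prec (IsAdicComplete.toIsPrecomplete (I := maximalIdeal R)
    (M := R)) (f := b) (fun {k n} hkn => by
      rw [SModEq.sub_mem, Ideal.smul_eq_mul, Ideal.mul_top]
      exact Ideal.pow_le_pow_right (Nat.le_succ k) (by
        rw [← neg_sub, neg_mem_iff]; exact hcompat' k n hkn))
  have hL' : ∀ n, b n - L ∈ maximalIdeal R ^ (n + 1) := fun n => by
    have h1 : b (n + 1) - L ∈ maximalIdeal R ^ (n + 1) := by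
      have := hL (n + 1)
      rw [SModEq.sub_mem, Ideal.smul_eq_mul, Ideal.mul_top] at this
      exact this
    have h2 := hcompat n
    have : b n - L = (b (n + 1) - L) - (b (n + 1) - b n) := by ring
    rw [this]
    exact Ideal.sub_mem _ h1 h2
  -- `m - algebraMapΓ f L` vanishes on all levels
  refine ⟨L, ?_⟩
  have hzero := eq_zero_of_forall_restrict_eq_zero f (m - algebraMapΓ f L) fun n => by
    rw [map_sub, restrict_algebraMapΓ' f (maximalIdeal R) n L, ← hbres n, ← map_sub, ← map_sub,
      Ideal.Quotient.eq_zero_iff_mem.mpr (hL' n), map_zero]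
  rw [sub_eq_zero] at hzero
  exact hzero.symm

end Literature.AlgebraicGeometry.Morphisms
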